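import Summits.QuantumFields.YangMills.Theorems.BalabanUVNodesN11TkNoExpansionSumTransportIntegrable
import Summits.QuantumFields.YangMills.Theorems.BalabanUVNodesN11NoExpansionGeneralStep

/-!
# DAG node N11 — THE GENERAL-HISTORY NO-EXPANSION (S1ᵀ) IDENTITY UNDER GRAPH-INTEGRABILITY: p543015's three theorems (`…_of_zetaSpecChiAt`) with the SUP BOUND
# on the new integrand per old branch (`hC`) replaced by its integrability along the averaging graph (`hI`) — step three of re-typing the analytic binder

WHY.  Step three of re-typing the analytic binder (see `…N11TkFullBondTransportIntegrable`): p543015's general-history (S1ᵀ) identity and its two clause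
wrappers, VERBATIM, with the sup bound `hC` on the new integrand per old branch replaced by graph-integrability `hI`.  The proofs are p543015's with g3's lemma and
the additivity step taken from `…N11TkNoExpansionSumTransportIntegrable` (additivity now enters as one more a.e. event in the final `filter_upwards`).

WHAT THIS FILE PROVES (0 `sorry`, 0 `def`).  ★★ `slotsT_succ_ae_eq_sect2Slot_of_zetaSpecChiAt_of_integrable`, `hasSect2FormAtZ_clause_succ_of_zetaSpecChiAt_of_integrable`,
`clause_succ_of_zetaSpecChiAt_of_clause_of_integrable`.  Sources: [III] Theorem p. 245, (3.24)–(3.25) p. 270, (2.18) p. 257, (2.20)–(2.23) p. 258, (3.1) p. 264, (3.16) p. 268.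

HONEST SCOPE.  Helper lane of K1⁷ `stmt-QuantumFields-20542` (dag-n11-d g9); [folklore] measure theory (disintegration along Bałaban's averaging of record, `HaarAC`) over the
tree's OWN kernels and records; nothing of Bałaban's estimates is asserted; no binder of an ACCEPTED theorem is edited (new `_of_integrable` theorems stand beside the
bounded ones); director-ym №186 (1) respected (no value law for `Zh` at `k ≥ 1` is posited).  N11 is NOT discharged; counts unmoved (typed 28∕28 · discharged 5∕27).  One
finite four-torus programme at fixed `ε = L^{−K}`; NOT ℝ⁴, NOT OS, NOT a mass gap, NOT Clay.
-/

noncomputable section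

open MeasureTheory
open scoped BigOperators Matrix.Norms.L2Operator

namespace Summit.QuantumFields.YangMills.Theorems.BalabanUVNodesN11NoExpansionGeneralStepIntegrable

open Literature.MathematicalPhysics.QuantumFieldTheory.Balaban1983to89 T4Continuum Node00 Node00.Tk DagBinding
open B15DeterminingSets
open BalabanUVNodesN11NoExpansionZetaSpecSucc (noExpIntegrandAt_eq_zetaFactor_mul)
open BalabanUVNodesN11TkNoExpansionSumTransportIntegrable (TkOfRecord_succ_ae_eq_sum_transportOfRecord_of_Omega_empty_of_integrable transportOfRecord_finset_sum_ae)

variable {F : T4Family} {N : ℕ} [NeZero N]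

section Positive

variable (θ : Stage13Params F N) (p : B12.RunParams)

/-- **★★ THE (S1ᵀ)₁₃ IDENTITY AT A NO-EXPANSION NEW SEQUENCE AFTER AN ARBITRARY HISTORY, UNDER OLD-FACTOR AGREEMENT AND THE GENERATION-`k` ζ-SPEC WITH THE
OLD FRONT FACTOR — ANY WEIGHT FAMILY.**  Let `s′` have `Ω_{k+1}(s′) = ∅` (`k < K`; nothing asked of `Ω_1, …, Ω_k`), `W` any 𝐓-weight family, `(t, E_k, U_k)` a
§2 witness of `ρ_k`'s slot at `init s′` (identity a.e. ON THE `χ_k(init s′)`-SUPPORT — `hid`), and `(t′, E_{k+1}, U_{k+1})` the proposed witness at `s′`.  Suppose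
(ii) OLD-FACTOR AGREEMENT ((3.24)): for every old branch `S`, `𝐓_k(init s′,S)[e^{A_{k+1}(s′)}]_S (U, V′) = κ·𝐓_k(init s′,S)[e^{A_k(init s′)}]_S (U)`;
(iii) THE GENERATION-`k` SPEC WITH `χ_k` on the averaging graph: `ζ_k(T)(U,Ū)·w_k(∅,∅,∅)(U,Ū) = c·χ_k(init s′)(U)·w_k(s′)(U,Ū)`, `c·κ = 1`; the displayed
joint measurability of the new integrand per old branch and its INTEGRABILITY ALONG THE AVERAGING GRAPH (this file's re-typing of p543015's sup bound).  Then `slotT_{k+1}(s′)(V′) = 𝐓_{k+1}(s′)e^{A_{k+1}(s′)}(V′)` for `dV′`-a.e. `V′` on the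
`χ_{k+1}(s′)`-support.  Proof: def-T's slot is `T_k[w_k(s′)·χ_k·slot_k(init s′)]` =ᵐ `T_k[w_k(s′)·χ_k·Σ_S 𝐓_k(init s′,S)e^{A_k}_S]` (`hid` on the support,
both sides `0` off it; `transportK_congr_ae_family`); 11a's slot is =ᵐ `Σ_S T_k[ζ_k w_k·𝐓_k(init s′,S)e^{A_{k+1}}_S]` (g3) `= T_k[Σ_S …]`; the two integrands AGREE
ON THE GRAPH `V′ = Ū` by (ii)–(iii); g3's `transportK_congr_ae_of_fibre` closes.
[cite: Balaban1988Convergent, Theorem p.245, (3.24)–(3.25) p.270, (2.18) p.257, (2.20)–(2.23) p.258, (3.1) p.264, (3.16) p.268] -/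
theorem slotsT_succ_ae_eq_sect2Slot_of_zetaSpecChiAt_of_integrable {k : ℕ} (hk : k < p.K)
    (s : SeqOfRecord F θ.ν θ.τ9.M (gOfRecord₁₃ F N θ p) p.K (k + 1)) (hΩ : s.Ω (k + 1) = ∅) (W : TkWeights F N (FluctV N) p.K)
    (Rz : Sect2.Residual (F.P p.K) (MatA N))
    (t : Sect2.TermValues (F.P p.K) (MatA N) (FluctV N) θ.τ9.M) (Ek : ℝ) (U : BgMap F N p.K)
    (hid : ∀ᵐ U₀ ∂fieldMeasure (F.P p.K) k (SU N),
      chiSeqOfRecord F N θ.ν θ.τ9.M (gOfRecord₁₃ F N θ p) p.K k s.init U₀ ≠ 0 →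
        slotsOfRecord F N θ.ν θ.τ9 (EOfRecord₁₃ F N θ) (wOfRecord₉ F N θ.toStage9Params) θ.ppSel p
            (gOfRecord₁₃ F N θ p) k s.init U₀ =
          sect2Slot F N (FluctV N) p.K (settingOfRecord₁₃ F N θ p) Rz W s.init t Ek U U₀)
    (Rz' : Sect2.Residual (F.P p.K) (MatA N))
    (t' : Sect2.TermValues (F.P p.K) (MatA N) (FluctV N) θ.τ9.M) (Ek' : ℝ) (U' : BgMap F N p.K)
    {κ c : ℝ} (hcκ : c * κ = 1)
    (hbranch : ∀ S ∈ admSOfRecord F θ.ν θ.τ9.M (gOfRecord₁₃ F N θ p) p.K k s.init,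
      ∀ (V' : GaugeField (F.P p.K) (k + 1) (SU N)) (U₀ : GaugeField (F.P p.K) k (SU N)),
        tkBranchOfRecord F N (FluctV N) θ.ν θ.τ9.M _ p.K W s.init S k
            (fun ω => sect2Operand F N (FluctV N) p.K (settingOfRecord₁₃ F N θ p) Rz' s t' Ek' U' (S, fun j => (ω j).2) (fun j => (ω j).1))
            (pairCfgAt (V := FluctV N) k V' U₀) =
          κ * tkBranchOfRecord F N (FluctV N) θ.ν θ.τ9.M _ p.K W s.init S k
            (fun ω => sect2Operand F N (FluctV N) p.K (settingOfRecord₁₃ F N θ p) Rz s.init t Ek U (S, fun j => (ω j).2) (fun j => (ω j).1))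
            (baseCfg k U₀))
    (hζχ : ∀ U₀ : GaugeField (F.P p.K) k (SU N),
      W.ζ k Set.univ (pairCfgAt (V := FluctV N) k ((avOfRecord F N p.K k).avg U₀) U₀) *
          W.w k ∅ ∅ ∅ (pairCfgAt (V := FluctV N) k ((avOfRecord F N p.K k).avg U₀) U₀) =
        c * (chiSeqOfRecord F N θ.ν θ.τ9.M (gOfRecord₁₃ F N θ p) p.K k s.init U₀ *
          wOfRecord₉ F N θ.toStage9Params p (gOfRecord₁₃ F N θ p) k s U₀ ((avOfRecord F N p.K k).avg U₀)))
    (hm : ∀ S ∈ admSOfRecord F θ.ν θ.τ9.M (gOfRecord₁₃ F N θ p) p.K k s.init,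
      Measurable (Function.uncurry (noExpIntegrandAt F N (FluctV N) p.K k W
        (tkBranchOfRecord F N (FluctV N) θ.ν θ.τ9.M _ p.K W s.init S k
          (fun ω => sect2Operand F N (FluctV N) p.K (settingOfRecord₁₃ F N θ p) Rz' s t' Ek' U' (S, fun j => (ω j).2) (fun j => (ω j).1))))))
    (hI : ∀ S ∈ admSOfRecord F θ.ν θ.τ9.M (gOfRecord₁₃ F N θ p) p.K k s.init,
      Integrable (fun U₀ : GaugeField (F.P p.K) k (SU N) => noExpIntegrandAt F N (FluctV N) p.K k W
        (tkBranchOfRecord F N (FluctV N) θ.ν θ.τ9.M _ p.K W s.init S k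
          (fun ω => sect2Operand F N (FluctV N) p.K (settingOfRecord₁₃ F N θ p) Rz' s t' Ek' U' (S, fun j => (ω j).2) (fun j => (ω j).1)))
        ((avOfRecord F N p.K k).avg U₀) U₀) (fieldMeasure (F.P p.K) k (SU N))) :
    ∀ᵐ V' ∂fieldMeasure (F.P p.K) (k + 1) (SU N),
      chiSeqOfRecord F N θ.ν θ.τ9.M (gOfRecord₁₃ F N θ p) p.K (k + 1) s V' ≠ 0 →
        slotsTOfRecord F N θ.ν θ.τ9 (EOfRecord₁₃ F N θ) (wOfRecord₉ F N θ.toStage9Params) θ.ppSel p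
            (gOfRecord₁₃ F N θ p) (k + 1) s V' =
          sect2Slot F N (FluctV N) p.K (settingOfRecord₁₃ F N θ p) Rz' W s t' Ek' U' V' := by
  classical
  -- abbreviations: the old branches of the old operand at the base configuration, and the new integrand per old branch
  set B : (ℕ → Set (Site (F.P p.K) 0)) → GaugeField (F.P p.K) k (SU N) → ℝ := fun S U₀ =>
    tkBranchOfRecord F N (FluctV N) θ.ν θ.τ9.M _ p.K W s.init S k
      (fun ω => sect2Operand F N (FluctV N) p.K (settingOfRecord₁₃ F N θ p) Rz s.init t Ek U (S, fun j => (ω j).2) (fun j => (ω j).1))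
      (baseCfg k U₀) with hB
  set G : (ℕ → Set (Site (F.P p.K) 0)) → GaugeField (F.P p.K) (k + 1) (SU N) → GaugeField (F.P p.K) k (SU N) → ℝ := fun S V' U₀ =>
    noExpIntegrandAt F N (FluctV N) p.K k W
      (tkBranchOfRecord F N (FluctV N) θ.ν θ.τ9.M _ p.K W s.init S k
        (fun ω => sect2Operand F N (FluctV N) p.K (settingOfRecord₁₃ F N θ p) Rz' s t' Ek' U' (S, fun j => (ω j).2) (fun j => (ω j).1)))
      V' U₀ with hG
  set A := admSOfRecord F θ.ν θ.τ9.M (gOfRecord₁₃ F N θ p) p.K k s.init with hA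
  set χk : GaugeField (F.P p.K) k (SU N) → ℝ := chiSeqOfRecord F N θ.ν θ.τ9.M (gOfRecord₁₃ F N θ p) p.K k s.init with hχk
  -- (1) def-T's slot: a.e. the transport of `w(s′)·χ_k·Σ_S B_S` (SLaw's identity at `init s′` ON the support; both sides vanish off it)
  have hsect : ∀ U₀ : GaugeField (F.P p.K) k (SU N),
      sect2Slot F N (FluctV N) p.K (settingOfRecord₁₃ F N θ p) Rz W s.init t Ek U U₀ = ∑ S ∈ A, B S U₀ :=
    fun U₀ => TkOfRecord_apply F N (FluctV N) θ.ν θ.τ9.M _ p.K W k s.init _ U₀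
  have h1 := transportK_congr_ae_family (avOfRecord_measurable F N p.K k) (avOfRecord_haarAC F N p.K k hk)
    (f := fun V' U₀ => wOfRecord₉ F N θ.toStage9Params p (gOfRecord₁₃ F N θ p) k s U₀ V' *
      (χk U₀ * slotsOfRecord F N θ.ν θ.τ9 (EOfRecord₁₃ F N θ) (wOfRecord₉ F N θ.toStage9Params) θ.ppSel p (gOfRecord₁₃ F N θ p) k s.init U₀))
    (g := fun V' U₀ => wOfRecord₉ F N θ.toStage9Params p (gOfRecord₁₃ F N θ p) k s U₀ V' * (χk U₀ * ∑ S ∈ A, B S U₀))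
    (hid.mono fun U₀ hU V' => by
      by_cases hne : χk U₀ = 0
      · simp only [hne, zero_mul, mul_zero]
      · rw [hU hne, hsect U₀])
  -- (2) 11a's slot: a.e. the sum over the old index of the transports of the new integrands (g3), = the transport of their sum (additivity)
  have h2 := TkOfRecord_succ_ae_eq_sum_transportOfRecord_of_Omega_empty_of_integrable θ.ν θ.τ9.M _ p.K W hk s hΩ
    (sect2Operand F N (FluctV N) p.K (settingOfRecord₁₃ F N θ p) Rz' s t' Ek' U') hm hI
  have hsum : ∀ᵐ V' ∂fieldMeasure (F.P p.K) (k + 1) (SU N),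
      transportOfRecord F N p.K k (fun U₀ => ∑ S ∈ A, G S V' U₀) V' = ∑ S ∈ A, transportOfRecord F N p.K k (G S V') V' :=
    transportOfRecord_finset_sum_ae F N p.K k hk A G (fun S hS => hm S hS) (fun S hS => hI S hS)
  -- (3) the two integrand families AGREE ON THE GRAPH `V′ = Ū`: old-factor agreement, the spec with `χ_k`, `c·κ = 1`
  have hfib : ∀ U₀ : GaugeField (F.P p.K) k (SU N),
      wOfRecord₉ F N θ.toStage9Params p (gOfRecord₁₃ F N θ p) k s U₀ ((avOfRecord F N p.K k).avg U₀) * (χk U₀ * ∑ S ∈ A, B S U₀) =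
        ∑ S ∈ A, G S ((avOfRecord F N p.K k).avg U₀) U₀ := by
    intro U₀
    rw [← mul_assoc, Finset.mul_sum]
    refine Finset.sum_congr rfl fun S hS => ?_
    simp only [hG, hB]
    rw [noExpIntegrandAt_eq_zetaFactor_mul, hζχ U₀, hbranch S hS]
    calc wOfRecord₉ F N θ.toStage9Params p (gOfRecord₁₃ F N θ p) k s U₀ ((avOfRecord F N p.K k).avg U₀) * χk U₀ *
          tkBranchOfRecord F N (FluctV N) θ.ν θ.τ9.M _ p.K W s.init S k
            (fun ω => sect2Operand F N (FluctV N) p.K (settingOfRecord₁₃ F N θ p) Rz s.init t Ek U (S, fun j => (ω j).2)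
              (fun j => (ω j).1)) (baseCfg k U₀)
        = (c * κ) * (wOfRecord₉ F N θ.toStage9Params p (gOfRecord₁₃ F N θ p) k s U₀ ((avOfRecord F N p.K k).avg U₀) * χk U₀ *
          tkBranchOfRecord F N (FluctV N) θ.ν θ.τ9.M _ p.K W s.init S k
            (fun ω => sect2Operand F N (FluctV N) p.K (settingOfRecord₁₃ F N θ p) Rz s.init t Ek U (S, fun j => (ω j).2)
              (fun j => (ω j).1)) (baseCfg k U₀)) := by rw [hcκ, one_mul]
      _ = c * (χk U₀ * wOfRecord₉ F N θ.toStage9Params p (gOfRecord₁₃ F N θ p) k s U₀ ((avOfRecord F N p.K k).avg U₀)) *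
          (κ * tkBranchOfRecord F N (FluctV N) θ.ν θ.τ9.M _ p.K W s.init S k
            (fun ω => sect2Operand F N (FluctV N) p.K (settingOfRecord₁₃ F N θ p) Rz s.init t Ek U (S, fun j => (ω j).2)
              (fun j => (ω j).1)) (baseCfg k U₀)) := by ring
  have h3 := transportK_congr_ae_of_fibre (avOfRecord_measurable F N p.K k) (avOfRecord_haarAC F N p.K k hk)
    (f := fun V' U₀ => wOfRecord₉ F N θ.toStage9Params p (gOfRecord₁₃ F N θ p) k s U₀ V' * (χk U₀ * ∑ S ∈ A, B S U₀))
    (g := fun V' U₀ => ∑ S ∈ A, G S V' U₀) hfib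
  -- (4) assemble
  filter_upwards [h1, h2, h3, hsum] with V' e1 e2 e3 e4 _
  rw [slotsTOfRecord_succ_apply]
  show T4AveragingDisintegration.transportK (avOfRecord F N p.K k).avg _ V' = _
  rw [e1, e3]
  show transportOfRecord F N p.K k (fun U₀ => ∑ S ∈ A, G S V' U₀) V' = _
  rw [e4]
  exact e2.symm

/-- **… HENCE THE DICHOTOMY CLAUSE AT `s′` ONE LEVEL UP** (identity branch), under the same hypotheses. [cite: Balaban1988Convergent, (2.17)–(2.18) p.257, (3.25) p.270] -/
theorem hasSect2FormAtZ_clause_succ_of_zetaSpecChiAt_of_integrable {k : ℕ} (hk : k < p.K)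
    (s : SeqOfRecord F θ.ν θ.τ9.M (gOfRecord₁₃ F N θ p) p.K (k + 1)) (hΩ : s.Ω (k + 1) = ∅) (W : TkWeights F N (FluctV N) p.K)
    (Rz : Sect2.Residual (F.P p.K) (MatA N))
    (t : Sect2.TermValues (F.P p.K) (MatA N) (FluctV N) θ.τ9.M) (Ek : ℝ) (U : BgMap F N p.K)
    (hid : ∀ᵐ U₀ ∂fieldMeasure (F.P p.K) k (SU N),
      chiSeqOfRecord F N θ.ν θ.τ9.M (gOfRecord₁₃ F N θ p) p.K k s.init U₀ ≠ 0 →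
        slotsOfRecord F N θ.ν θ.τ9 (EOfRecord₁₃ F N θ) (wOfRecord₉ F N θ.toStage9Params) θ.ppSel p
            (gOfRecord₁₃ F N θ p) k s.init U₀ =
          sect2Slot F N (FluctV N) p.K (settingOfRecord₁₃ F N θ p) Rz W s.init t Ek U U₀)
    (Rz' : Sect2.Residual (F.P p.K) (MatA N))
    (t' : Sect2.TermValues (F.P p.K) (MatA N) (FluctV N) θ.τ9.M) (Ek' : ℝ) (U' : BgMap F N p.K)
    {κ c : ℝ} (hcκ : c * κ = 1)
    (hbranch : ∀ S ∈ admSOfRecord F θ.ν θ.τ9.M (gOfRecord₁₃ F N θ p) p.K k s.init,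
      ∀ (V' : GaugeField (F.P p.K) (k + 1) (SU N)) (U₀ : GaugeField (F.P p.K) k (SU N)),
        tkBranchOfRecord F N (FluctV N) θ.ν θ.τ9.M _ p.K W s.init S k
            (fun ω => sect2Operand F N (FluctV N) p.K (settingOfRecord₁₃ F N θ p) Rz' s t' Ek' U' (S, fun j => (ω j).2) (fun j => (ω j).1))
            (pairCfgAt (V := FluctV N) k V' U₀) =
          κ * tkBranchOfRecord F N (FluctV N) θ.ν θ.τ9.M _ p.K W s.init S k
            (fun ω => sect2Operand F N (FluctV N) p.K (settingOfRecord₁₃ F N θ p) Rz s.init t Ek U (S, fun j => (ω j).2) (fun j => (ω j).1))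
            (baseCfg k U₀))
    (hζχ : ∀ U₀ : GaugeField (F.P p.K) k (SU N),
      W.ζ k Set.univ (pairCfgAt (V := FluctV N) k ((avOfRecord F N p.K k).avg U₀) U₀) *
          W.w k ∅ ∅ ∅ (pairCfgAt (V := FluctV N) k ((avOfRecord F N p.K k).avg U₀) U₀) =
        c * (chiSeqOfRecord F N θ.ν θ.τ9.M (gOfRecord₁₃ F N θ p) p.K k s.init U₀ *
          wOfRecord₉ F N θ.toStage9Params p (gOfRecord₁₃ F N θ p) k s U₀ ((avOfRecord F N p.K k).avg U₀)))
    (hm : ∀ S ∈ admSOfRecord F θ.ν θ.τ9.M (gOfRecord₁₃ F N θ p) p.K k s.init,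
      Measurable (Function.uncurry (noExpIntegrandAt F N (FluctV N) p.K k W
        (tkBranchOfRecord F N (FluctV N) θ.ν θ.τ9.M _ p.K W s.init S k
          (fun ω => sect2Operand F N (FluctV N) p.K (settingOfRecord₁₃ F N θ p) Rz' s t' Ek' U' (S, fun j => (ω j).2) (fun j => (ω j).1))))))
    (hI : ∀ S ∈ admSOfRecord F θ.ν θ.τ9.M (gOfRecord₁₃ F N θ p) p.K k s.init,
      Integrable (fun U₀ : GaugeField (F.P p.K) k (SU N) => noExpIntegrandAt F N (FluctV N) p.K k W
        (tkBranchOfRecord F N (FluctV N) θ.ν θ.τ9.M _ p.K W s.init S k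
          (fun ω => sect2Operand F N (FluctV N) p.K (settingOfRecord₁₃ F N θ p) Rz' s t' Ek' U' (S, fun j => (ω j).2) (fun j => (ω j).1)))
        ((avOfRecord F N p.K k).avg U₀) U₀) (fieldMeasure (F.P p.K) k (SU N))) :
    slotsTOfRecord F N θ.ν θ.τ9 (EOfRecord₁₃ F N θ) (wOfRecord₉ F N θ.toStage9Params) θ.ppSel p (gOfRecord₁₃ F N θ p) (k + 1) s = 0 ∨
      ∀ᵐ V' ∂fieldMeasure (F.P p.K) (k + 1) (SU N),
        chiSeqOfRecord F N θ.ν θ.τ9.M (gOfRecord₁₃ F N θ p) p.K (k + 1) s V' ≠ 0 →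
          slotsTOfRecord F N θ.ν θ.τ9 (EOfRecord₁₃ F N θ) (wOfRecord₉ F N θ.toStage9Params) θ.ppSel p
              (gOfRecord₁₃ F N θ p) (k + 1) s V' =
            sect2Slot F N (FluctV N) p.K (settingOfRecord₁₃ F N θ p) Rz' W s t' Ek' U' V' :=
  Or.inr (slotsT_succ_ae_eq_sect2Slot_of_zetaSpecChiAt_of_integrable θ p hk s hΩ W Rz t Ek U hid Rz' t' Ek' U' hcκ hbranch hζχ hm hI)

/-- **★ CLAUSE-KEYED**: if the §2 DICHOTOMY (absent slot OR identity on the support) holds at `init s′` — the shape of `SLaw k`'s clause — then the 𝐓-image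
dichotomy holds at `s′` (the `slot_k(init s′) = 0` branch gives `slotT_{k+1}(s′) = 0`: def-T's transport of the zero integrand).
[cite: Balaban1988Convergent, (2.17)–(2.18) p.257, (3.1) p.264, (3.25) p.270] -/
theorem clause_succ_of_zetaSpecChiAt_of_clause_of_integrable {k : ℕ} (hk : k < p.K)
    (s : SeqOfRecord F θ.ν θ.τ9.M (gOfRecord₁₃ F N θ p) p.K (k + 1)) (hΩ : s.Ω (k + 1) = ∅) (W : TkWeights F N (FluctV N) p.K)
    (Rz : Sect2.Residual (F.P p.K) (MatA N))
    (t : Sect2.TermValues (F.P p.K) (MatA N) (FluctV N) θ.τ9.M) (Ek : ℝ) (U : BgMap F N p.K)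
    (hid : slotsOfRecord F N θ.ν θ.τ9 (EOfRecord₁₃ F N θ) (wOfRecord₉ F N θ.toStage9Params) θ.ppSel p (gOfRecord₁₃ F N θ p) k s.init = 0 ∨
      ∀ᵐ U₀ ∂fieldMeasure (F.P p.K) k (SU N),
        chiSeqOfRecord F N θ.ν θ.τ9.M (gOfRecord₁₃ F N θ p) p.K k s.init U₀ ≠ 0 →
          slotsOfRecord F N θ.ν θ.τ9 (EOfRecord₁₃ F N θ) (wOfRecord₉ F N θ.toStage9Params) θ.ppSel p
              (gOfRecord₁₃ F N θ p) k s.init U₀ =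
            sect2Slot F N (FluctV N) p.K (settingOfRecord₁₃ F N θ p) Rz W s.init t Ek U U₀)
    (Rz' : Sect2.Residual (F.P p.K) (MatA N))
    (t' : Sect2.TermValues (F.P p.K) (MatA N) (FluctV N) θ.τ9.M) (Ek' : ℝ) (U' : BgMap F N p.K)
    {κ c : ℝ} (hcκ : c * κ = 1)
    (hbranch : ∀ S ∈ admSOfRecord F θ.ν θ.τ9.M (gOfRecord₁₃ F N θ p) p.K k s.init,
      ∀ (V' : GaugeField (F.P p.K) (k + 1) (SU N)) (U₀ : GaugeField (F.P p.K) k (SU N)),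
        tkBranchOfRecord F N (FluctV N) θ.ν θ.τ9.M _ p.K W s.init S k
            (fun ω => sect2Operand F N (FluctV N) p.K (settingOfRecord₁₃ F N θ p) Rz' s t' Ek' U' (S, fun j => (ω j).2) (fun j => (ω j).1))
            (pairCfgAt (V := FluctV N) k V' U₀) =
          κ * tkBranchOfRecord F N (FluctV N) θ.ν θ.τ9.M _ p.K W s.init S k
            (fun ω => sect2Operand F N (FluctV N) p.K (settingOfRecord₁₃ F N θ p) Rz s.init t Ek U (S, fun j => (ω j).2) (fun j => (ω j).1))
            (baseCfg k U₀))
    (hζχ : ∀ U₀ : GaugeField (F.P p.K) k (SU N),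
      W.ζ k Set.univ (pairCfgAt (V := FluctV N) k ((avOfRecord F N p.K k).avg U₀) U₀) *
          W.w k ∅ ∅ ∅ (pairCfgAt (V := FluctV N) k ((avOfRecord F N p.K k).avg U₀) U₀) =
        c * (chiSeqOfRecord F N θ.ν θ.τ9.M (gOfRecord₁₃ F N θ p) p.K k s.init U₀ *
          wOfRecord₉ F N θ.toStage9Params p (gOfRecord₁₃ F N θ p) k s U₀ ((avOfRecord F N p.K k).avg U₀)))
    (hm : ∀ S ∈ admSOfRecord F θ.ν θ.τ9.M (gOfRecord₁₃ F N θ p) p.K k s.init,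
      Measurable (Function.uncurry (noExpIntegrandAt F N (FluctV N) p.K k W
        (tkBranchOfRecord F N (FluctV N) θ.ν θ.τ9.M _ p.K W s.init S k
          (fun ω => sect2Operand F N (FluctV N) p.K (settingOfRecord₁₃ F N θ p) Rz' s t' Ek' U' (S, fun j => (ω j).2) (fun j => (ω j).1))))))
    (hI : ∀ S ∈ admSOfRecord F θ.ν θ.τ9.M (gOfRecord₁₃ F N θ p) p.K k s.init,
      Integrable (fun U₀ : GaugeField (F.P p.K) k (SU N) => noExpIntegrandAt F N (FluctV N) p.K k W
        (tkBranchOfRecord F N (FluctV N) θ.ν θ.τ9.M _ p.K W s.init S k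
          (fun ω => sect2Operand F N (FluctV N) p.K (settingOfRecord₁₃ F N θ p) Rz' s t' Ek' U' (S, fun j => (ω j).2) (fun j => (ω j).1)))
        ((avOfRecord F N p.K k).avg U₀) U₀) (fieldMeasure (F.P p.K) k (SU N))) :
    slotsTOfRecord F N θ.ν θ.τ9 (EOfRecord₁₃ F N θ) (wOfRecord₉ F N θ.toStage9Params) θ.ppSel p (gOfRecord₁₃ F N θ p) (k + 1) s = 0 ∨
      ∀ᵐ V' ∂fieldMeasure (F.P p.K) (k + 1) (SU N),
        chiSeqOfRecord F N θ.ν θ.τ9.M (gOfRecord₁₃ F N θ p) p.K (k + 1) s V' ≠ 0 →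
          slotsTOfRecord F N θ.ν θ.τ9 (EOfRecord₁₃ F N θ) (wOfRecord₉ F N θ.toStage9Params) θ.ppSel p
              (gOfRecord₁₃ F N θ p) (k + 1) s V' =
            sect2Slot F N (FluctV N) p.K (settingOfRecord₁₃ F N θ p) Rz' W s t' Ek' U' V' := by
  rcases hid with h0 | hid
  · -- absent slot at `init s′` ⇒ absent pre-𝐑 slot at `s′`
    refine Or.inl ?_
    funext V'
    rw [slotsTOfRecord_succ_apply, h0]
    show transportOfRecord F N p.K k (fun U => _ * (_ * (0 : ℝ))) V' = 0
    simp only [mul_zero]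
    show T4AveragingDisintegration.kernelTransport _ _ _ (fun _ => (0 : ℝ)) V' = 0
    simp only [T4AveragingDisintegration.kernelTransport, integral_zero, mul_zero]
  · exact hasSect2FormAtZ_clause_succ_of_zetaSpecChiAt_of_integrable θ p hk s hΩ W Rz t Ek U hid Rz' t' Ek' U' hcκ hbranch hζχ hm hI

end Positive

end Summit.QuantumFields.YangMills.Theorems.BalabanUVNodesN11NoExpansionGeneralStepIntegrable

end
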